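import Mathlib
import HarnessLib
import Summits.NavierStokesRegularity.NavierStokesRegularity.Theorems.PoloidalWindowDoorPoloidalWindowRigidityUntwistedSeparation

/-!
# Route `PoloidalWindowDoor`, crux `PoloidalWindowRigidity` (K2, stmt-NavierStokesRegularity-19708), skeleton `lrc-jet` v5,
# stub `stub_untwisted` — brick F1′: AN UNTWISTED FUNCTION HAS THE SAME LEVEL CURVES IN EVERY HORIZONTAL PLANE (bracket form)

Cell ns-regularity-ideate, K2 lead ns-poloidal-K2-p1 (gen 6; `--supports stmt-NavierStokesRegularity-19708`, helper toward the registered stub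
`stub_untwisted`; BRIEF-v5-bricks-v2 (S1)).  Pure calculus on `ℝ³` (indices `0,1` horizontal, `2` the height), ODE-free.

If `∂₂w = P(w, y₂)` on an open set `U` (the untwisted / «Case II» form of the twist condition `{∂₂w, w}ₕ ≡ 0`), then along every vertical segment
contained in `U` the horizontal gradient `∇ₕw` keeps its DIRECTION: for the bracket with the gradient at the foot `y₁` of the segment,
`β(ζ) := ∂₀w(y_ζ)·∂₁w(y₁) − ∂₁w(y_ζ)·∂₀w(y₁)` (`y_ζ = y₁ + (ζ − (y₁)₂)e₂`), one has `β′ = P_w(w(y_ζ), ζ)·β` (tree `fderiv_vert_hpartial`, p548007) and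
`β((y₁)₂) = 0`, so `β ≡ 0` by Grönwall.  Consequently, on a box every horizontal plane carries the same foliation by level curves of `w` as the base
plane — the only kinematic input the endgame of `stub_untwisted` needs (no flow function `w = G(u, y₂)` is required).

* `hasDerivAt_vertical_line` — `ζ ↦ w(y + (ζ − y₂)e₂)` has derivative `∂₂w`;
* `bracket_deriv` — `β′(ζ) = P_w·β(ζ)` along a vertical segment in `U`;
* `bracket_eq_zero_on_vertical_segment` — **`∇ₕw(y + (ζ − y₂)e₂) ∥ ∇ₕw(y)`** for every `ζ` with the closed vertical segment from `y` inside `U`.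

WHAT THIS IS NOT: not a claim about Navier–Stokes regularity and not the stub — calculus bookkeeping (bears_on LADDER-NS N0 via crux K2 = stmt-19708).
-/

noncomputable section

-- the summit and its single sub-problem share the name (CONVENTIONS §1), as in every Theorems file
set_option linter.dupNamespace false

namespace Summit.NavierStokesRegularity.NavierStokesRegularity.Theorems.PoloidalWindowDoorPoloidalWindowRigidityUntwistedBracket

open Set Function Filter Topology Metric
open Summit.NavierStokesRegularity.NavierStokesRegularity.Theorems.PoloidalWindowDoorPoloidalWindowRigidityConstantShearMeans
open Summit.NavierStokesRegularity.NavierStokesRegularity.Theorems.PoloidalWindowDoorLrcModEntireLeafwiseVertical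
open Summit.NavierStokesRegularity.NavierStokesRegularity.Theorems.PoloidalWindowDoorPoloidalWindowRigidityUntwistedSeparation

variable {w : EuclideanSpace ℝ (Fin 3) → ℝ} {P : ℝ × ℝ → ℝ} {U : Set (EuclideanSpace ℝ (Fin 3))}

/-- The vertical line through `y`, parametrised by the height: `ζ ↦ y + (ζ − y₂)e₂`; its height coordinate is `ζ`. [folklore] -/
theorem vline_apply_two (y : EuclideanSpace ℝ (Fin 3)) (ζ : ℝ) :
    (y + (ζ - y 2) • EuclideanSpace.single (2 : Fin 3) (1 : ℝ)) 2 = ζ := by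
  simp

/-- Its horizontal coordinates are those of `y`. [folklore] -/
theorem vline_apply_horizontal (y : EuclideanSpace ℝ (Fin 3)) (ζ : ℝ) {c : Fin 3} (hc : c ≠ 2) :
    (y + (ζ - y 2) • EuclideanSpace.single (2 : Fin 3) (1 : ℝ)) c = y c := by
  simp [hc]

/-- At the height of `y` the vertical line passes through `y`. [folklore] -/
theorem vline_self (y : EuclideanSpace ℝ (Fin 3)) :
    y + (y 2 - y 2) • EuclideanSpace.single (2 : Fin 3) (1 : ℝ) = y := by
  simp

/-- **Derivative along a vertical line**: for `g` differentiable at the point, `ζ ↦ g(y + (ζ − y₂)e₂)` has derivative `∂₂g` there. [folklore] -/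
theorem hasDerivAt_vertical_line {g : EuclideanSpace ℝ (Fin 3) → ℝ} (y : EuclideanSpace ℝ (Fin 3)) {ζ : ℝ}
    (hg : DifferentiableAt ℝ g (y + (ζ - y 2) • EuclideanSpace.single (2 : Fin 3) (1 : ℝ))) :
    HasDerivAt (fun ζ' : ℝ => g (y + (ζ' - y 2) • EuclideanSpace.single (2 : Fin 3) (1 : ℝ)))
      (fderiv ℝ g (y + (ζ - y 2) • EuclideanSpace.single (2 : Fin 3) (1 : ℝ)) (EuclideanSpace.single (2 : Fin 3) (1 : ℝ))) ζ := by
  have hline : HasDerivAt (fun ζ' : ℝ => y + (ζ' - y 2) • EuclideanSpace.single (2 : Fin 3) (1 : ℝ))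
      (EuclideanSpace.single (2 : Fin 3) (1 : ℝ)) ζ := by
    have h1 : HasDerivAt (fun ζ' : ℝ => ζ' - y 2) 1 ζ := (hasDerivAt_id ζ).sub_const (y 2)
    have h2 := h1.smul_const (EuclideanSpace.single (2 : Fin 3) (1 : ℝ))
    simpa using h2.const_add y
  exact hg.hasFDerivAt.comp_hasDerivAt ζ hline

/-- **The bracket ODE.**  With `A₀, A₁` two constants and `β(ζ) = ∂₀w(y_ζ)·A₁ − ∂₁w(y_ζ)·A₀` along the vertical line `y_ζ = y + (ζ − y₂)e₂`: if `y_ζ ∈ U`, where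
`∂₂w = P(w,y₂)` on the open `U` (`w ∈ C²`, `P` differentiable at the leaf points), then `β′(ζ) = P_w(w(y_ζ), ζ)·β(ζ)`. [folklore] -/
theorem bracket_deriv (hU : IsOpen U) (hw : ContDiff ℝ 2 w)
    (hPd : ∀ y ∈ U, DifferentiableAt ℝ P (w y, y 2))
    (hP : ∀ y ∈ U, fderiv ℝ w y (EuclideanSpace.single 2 (1 : ℝ)) = P (w y, y 2))
    (y : EuclideanSpace ℝ (Fin 3)) (A₀ A₁ : ℝ) {ζ : ℝ}
    (hζ : y + (ζ - y 2) • EuclideanSpace.single (2 : Fin 3) (1 : ℝ) ∈ U) :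
    HasDerivAt (fun ζ' : ℝ =>
        fderiv ℝ w (y + (ζ' - y 2) • EuclideanSpace.single (2 : Fin 3) (1 : ℝ)) (EuclideanSpace.single 0 (1 : ℝ)) * A₁ -
          fderiv ℝ w (y + (ζ' - y 2) • EuclideanSpace.single (2 : Fin 3) (1 : ℝ)) (EuclideanSpace.single 1 (1 : ℝ)) * A₀)
      (fderiv ℝ P (w (y + (ζ - y 2) • EuclideanSpace.single (2 : Fin 3) (1 : ℝ)), ζ) (1, 0) *
        (fderiv ℝ w (y + (ζ - y 2) • EuclideanSpace.single (2 : Fin 3) (1 : ℝ)) (EuclideanSpace.single 0 (1 : ℝ)) * A₁ -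
          fderiv ℝ w (y + (ζ - y 2) • EuclideanSpace.single (2 : Fin 3) (1 : ℝ)) (EuclideanSpace.single 1 (1 : ℝ)) * A₀)) ζ := by
  set yζ := y + (ζ - y 2) • EuclideanSpace.single (2 : Fin 3) (1 : ℝ) with hyζ
  have hd := differentiableAt_partial hw
  have h0 : HasDerivAt (fun ζ' : ℝ => fderiv ℝ w (y + (ζ' - y 2) • EuclideanSpace.single (2 : Fin 3) (1 : ℝ)) (EuclideanSpace.single 0 (1 : ℝ)))
      (fderiv ℝ (fun y' => fderiv ℝ w y' (EuclideanSpace.single 0 (1 : ℝ))) yζ (EuclideanSpace.single (2 : Fin 3) (1 : ℝ))) ζ :=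
    hasDerivAt_vertical_line (g := fun y' => fderiv ℝ w y' (EuclideanSpace.single 0 (1 : ℝ))) y (hd _ _)
  have h1 : HasDerivAt (fun ζ' : ℝ => fderiv ℝ w (y + (ζ' - y 2) • EuclideanSpace.single (2 : Fin 3) (1 : ℝ)) (EuclideanSpace.single 1 (1 : ℝ)))
      (fderiv ℝ (fun y' => fderiv ℝ w y' (EuclideanSpace.single 1 (1 : ℝ))) yζ (EuclideanSpace.single (2 : Fin 3) (1 : ℝ))) ζ :=
    hasDerivAt_vertical_line (g := fun y' => fderiv ℝ w y' (EuclideanSpace.single 1 (1 : ℝ))) y (hd _ _)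
  have h := (h0.mul_const A₁).sub (h1.mul_const A₀)
  refine h.congr_deriv ?_
  have hy2 : yζ 2 = ζ := vline_apply_two y ζ
  rw [fderiv_vert_hpartial hU hw hPd hP hζ (show (0 : Fin 3) ≠ 2 by decide),
    fderiv_vert_hpartial hU hw hPd hP hζ (show (1 : Fin 3) ≠ 2 by decide), hy2]
  ring

/-- **THE BRACKET VANISHES ALONG VERTICAL SEGMENTS** (Grönwall).  Let `∂₂w = P(w,y₂)` on the open `U` (`w ∈ C²`, `P` of class `C¹` near the leaf points),
`y ∈ U`, and suppose the closed vertical segment from `y` to height `ζ` lies in `U`.  Then the horizontal gradients at its two ends are parallel: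
`∂₀w(y_ζ)·∂₁w(y) − ∂₁w(y_ζ)·∂₀w(y) = 0`, `y_ζ = y + (ζ − y₂)e₂`. [folklore] -/
theorem bracket_eq_zero_on_vertical_segment (hU : IsOpen U) (hw : ContDiff ℝ 2 w)
    (hPc : ∀ y ∈ U, ContDiffAt ℝ 1 P (w y, y 2))
    (hP : ∀ y ∈ U, fderiv ℝ w y (EuclideanSpace.single 2 (1 : ℝ)) = P (w y, y 2))
    {y : EuclideanSpace ℝ (Fin 3)} {ζ : ℝ}
    (hseg : ∀ ζ' ∈ uIcc (y 2) ζ, y + (ζ' - y 2) • EuclideanSpace.single (2 : Fin 3) (1 : ℝ) ∈ U) :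
    fderiv ℝ w (y + (ζ - y 2) • EuclideanSpace.single (2 : Fin 3) (1 : ℝ)) (EuclideanSpace.single 0 (1 : ℝ)) *
        fderiv ℝ w y (EuclideanSpace.single 1 (1 : ℝ)) -
      fderiv ℝ w (y + (ζ - y 2) • EuclideanSpace.single (2 : Fin 3) (1 : ℝ)) (EuclideanSpace.single 1 (1 : ℝ)) *
        fderiv ℝ w y (EuclideanSpace.single 0 (1 : ℝ)) = 0 := by
  have hPd : ∀ y ∈ U, DifferentiableAt ℝ P (w y, y 2) := fun y hy => (hPc y hy).differentiableAt one_ne_zero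
  have hwd : Differentiable ℝ w := hw.differentiable (by norm_num)
  set e₂ : EuclideanSpace ℝ (Fin 3) := EuclideanSpace.single (2 : Fin 3) (1 : ℝ) with he₂
  set A₀ := fderiv ℝ w y (EuclideanSpace.single 0 (1 : ℝ)) with hA₀
  set A₁ := fderiv ℝ w y (EuclideanSpace.single 1 (1 : ℝ)) with hA₁
  -- the bracket along the line and its coefficient
  set β : ℝ → ℝ := fun ζ' => fderiv ℝ w (y + (ζ' - y 2) • e₂) (EuclideanSpace.single 0 (1 : ℝ)) * A₁ -
    fderiv ℝ w (y + (ζ' - y 2) • e₂) (EuclideanSpace.single 1 (1 : ℝ)) * A₀ with hβ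
  set a : ℝ → ℝ := fun ζ' => fderiv ℝ P (w (y + (ζ' - y 2) • e₂), ζ') (1, 0) with ha
  have hβ0 : β (y 2) = 0 := by
    simp only [hβ, sub_self, zero_smul, add_zero, hA₀, hA₁]; ring
  have hderiv : ∀ ζ' ∈ uIcc (y 2) ζ, HasDerivAt β (a ζ' * β ζ') ζ' := fun ζ' hζ' =>
    bracket_deriv hU hw hPd hP y A₀ A₁ (hseg ζ' hζ')
  -- continuity of the coefficient on the segment (hence a bound)
  have hline_cont : Continuous fun ζ' : ℝ => y + (ζ' - y 2) • e₂ := by fun_prop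
  have hacont : ContinuousOn a (uIcc (y 2) ζ) := by
    intro ζ' hζ'
    have hmem := hseg ζ' hζ'
    have hy2 : (y + (ζ' - y 2) • e₂) 2 = ζ' := vline_apply_two y ζ'
    -- `p ↦ DP(p)(1,0)` is continuous at the leaf point, and the leaf point depends continuously on `ζ'`
    have h1 : ContinuousAt (fun p : ℝ × ℝ => fderiv ℝ P p ((1 : ℝ), (0 : ℝ))) (w (y + (ζ' - y 2) • e₂), ζ') := by
      have hc := ((hPc _ hmem).fderiv_right (m := 0) le_rfl).continuousAt
      rw [hy2] at hc
      exact hc.clm_apply continuousAt_const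
    have h2 : ContinuousAt (fun ζ'' : ℝ => (w (y + (ζ'' - y 2) • e₂), ζ'')) ζ' :=
      ((hwd.continuous.comp hline_cont).continuousAt).prodMk continuousAt_id
    have h3 : ContinuousAt (fun ζ'' : ℝ => fderiv ℝ P (w (y + (ζ'' - y 2) • e₂), ζ'') ((1 : ℝ), (0 : ℝ))) ζ' :=
      ContinuousAt.comp (g := fun p : ℝ × ℝ => fderiv ℝ P p ((1 : ℝ), (0 : ℝ))) h1 h2
    exact h3.continuousWithinAt
  obtain ⟨K, hK⟩ := (isCompact_uIcc (a := y 2) (b := ζ)).exists_bound_of_continuousOn hacont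
  have hβcont : ContinuousOn β (uIcc (y 2) ζ) := fun ζ' hζ' => (hderiv ζ' hζ').continuousAt.continuousWithinAt
  have hbound : ∀ ζ' ∈ uIcc (y 2) ζ, ‖a ζ' * β ζ'‖ ≤ K * ‖β ζ'‖ + 0 := by
    intro ζ' hζ'
    rw [norm_mul, add_zero]
    exact mul_le_mul_of_nonneg_right (hK ζ' hζ') (norm_nonneg _)
  -- Grönwall on the segment, in both orientations
  have hgoal : β ζ = 0 := by
    rcases le_total (y 2) ζ with hle | hle
    · have hI : uIcc (y 2) ζ = Icc (y 2) ζ := uIcc_of_le hle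
      have h := norm_le_gronwallBound_of_norm_deriv_right_le (f := β) (f' := fun ζ' => a ζ' * β ζ') (δ := 0) (K := K) (ε := 0)
        (a := y 2) (b := ζ) (by rw [← hI]; exact hβcont)
        (fun x hx => (hderiv x (by rw [hI]; exact Ico_subset_Icc_self hx)).hasDerivWithinAt)
        (by rw [hβ0, norm_zero]) (fun x hx => hbound x (by rw [hI]; exact Ico_subset_Icc_self hx)) ζ (right_mem_Icc.mpr hle)
      rw [gronwallBound_ε0_δ0] at h
      exact norm_le_zero_iff.mp h
    · -- reflect: `γ(τ) = β(−τ)` on `[−y₂, −ζ]`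
      have hI : uIcc (y 2) ζ = Icc ζ (y 2) := uIcc_of_ge hle
      set γ : ℝ → ℝ := fun τ => β (-τ) with hγ
      have hγderiv : ∀ τ ∈ Icc (-(y 2)) (-ζ), HasDerivAt γ (-(a (-τ) * β (-τ))) τ := by
        intro τ hτ
        have hmem : -τ ∈ uIcc (y 2) ζ := by
          rw [hI]; exact ⟨by linarith [hτ.2], by linarith [hτ.1]⟩
        have h := (hderiv (-τ) hmem).scomp τ (hasDerivAt_neg τ)
        have h' : HasDerivAt (fun τ' => β (-τ')) ((-1 : ℝ) • (a (-τ) * β (-τ))) τ := h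
        simpa using h'
      have hγcont : ContinuousOn γ (Icc (-(y 2)) (-ζ)) := fun τ hτ => (hγderiv τ hτ).continuousAt.continuousWithinAt
      have h := norm_le_gronwallBound_of_norm_deriv_right_le (f := γ) (f' := fun τ => -(a (-τ) * β (-τ))) (δ := 0) (K := K) (ε := 0)
        (a := -(y 2)) (b := -ζ) hγcont (fun x hx => (hγderiv x (Ico_subset_Icc_self hx)).hasDerivWithinAt)
        (by simp [hγ, hβ0]) (fun x hx => by
          have hmem : -x ∈ uIcc (y 2) ζ := by
            rw [hI]; exact ⟨by linarith [hx.2], by linarith [hx.1]⟩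
          rw [norm_neg]
          simpa [hγ] using hbound (-x) hmem) (-ζ) (right_mem_Icc.mpr (by linarith))
      rw [gronwallBound_ε0_δ0] at h
      have : γ (-ζ) = 0 := norm_le_zero_iff.mp h
      simpa [hγ] using this
  simpa [hβ, he₂, hA₀, hA₁] using hgoal

end Summit.NavierStokesRegularity.NavierStokesRegularity.Theorems.PoloidalWindowDoorPoloidalWindowRigidityUntwistedBracket

end
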